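import Mathlib
import Summits.Ventures.PercRepro2.Tail2DBlockCalc
import Summits.Ventures.PercRepro2.Tail2DHarrisSP
import Summits.Ventures.PercRepro2.Tail2DFlowOneBlocks
import Summits.Ventures.PercRepro2.Tail2DFlowOneStep01
import Summits.Ventures.PercRepro2.Tail2DParFin
import Summits.Ventures.PercRepro2.Tail2DParFinFlip
import Summits.Ventures.PercRepro2.Tail2DParFinTop
import Summits.Ventures.PercRepro2.Tail2DParFinDiag
import Summits.Ventures.PercRepro2.Tail2DParFinCount
import Summits.Ventures.PercRepro2.Tail2DParFinRelax
import Summits.Ventures.PercRepro2.Tail2DParFinSubTop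
import Summits.Ventures.PercRepro2.Tail2DParFinSubTopB
import Summits.Ventures.PercRepro2.Tail2DParFinFibres
import Summits.Ventures.PercRepro2.Tail2DOneChange
import Summits.Ventures.PercRepro2.Tail2DOneChangeB
import Summits.Ventures.PercRepro2.Tail2DOneChangeC
import Summits.Ventures.PercRepro2.Tail2DFourIdent

/-!
# (SD) at `(3,0)` on `6` identical flow-one factors — an explicit one-change table
(seat mine-b, cell pub-perc-repro2; conjectures/MINE-B.md §44)

The rates are `P(c/a)/D(c/a)` with `P` of non-negative coefficients (found by an LP on the coefficients, verified
exactly; mining/mine-b/code/g42/k67_tables.json), applied through the generic theorem `sdomZ_of_oneChange`.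
-/

namespace Summit.Ventures.PercRepro2.Tail2D

open V2Closure Finset

namespace IdentSix30

/-- `D = 56 * a ^ 3 + 150 * a ^ 2 * c + 150 * a * c ^ 2 + 60 * c ^ 3` at `(3,0)` on `6` identical factors -/
noncomputable def dN (Y : V2Closure.SP) : ℚ := 56 * aY Y ^ 3 + 150 * aY Y ^ 2 * cY Y + 150 * aY Y * cY Y ^ 2 + 60 * cY Y ^ 3

/-- the identity rate by the type `(#R, #B)` -/
noncomputable def ιN (Y : V2Closure.SP) (r b : ℕ) : ℚ :=
  if r = 3 ∧ b = 1 then ((196 / 15 : ℚ) * aY Y ^ 3 + (388 / 15 : ℚ) * aY Y ^ 2 * cY Y + (529 / 30 : ℚ) * aY Y * cY Y ^ 2 + 5 * cY Y ^ 3) / dN Y else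
  if r = 4 ∧ b = 1 then ((392 / 15 : ℚ) * aY Y ^ 3 + (823 / 15 : ℚ) * aY Y ^ 2 * cY Y + 45 * aY Y * cY Y ^ 2 + 8 * cY Y ^ 3) / dN Y else
  if r = 5 ∧ b = 1 then ((98 / 3 : ℚ) * aY Y ^ 3 + 71 * aY Y ^ 2 * cY Y + 50 * aY Y * cY Y ^ 2 + 10 * cY Y ^ 3) / dN Y else
  if r = 3 ∧ b = 2 then ((49 / 2 : ℚ) * aY Y ^ 3 + (869 / 15 : ℚ) * aY Y ^ 2 * cY Y + (602 / 15 : ℚ) * aY Y * cY Y ^ 2 + (208 / 15 : ℚ) * cY Y ^ 3) / dN Y else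
  if r = 4 ∧ b = 2 then ((98 / 3 : ℚ) * aY Y ^ 3 + (1106 / 15 : ℚ) * aY Y ^ 2 * cY Y + (859 / 15 : ℚ) * aY Y * cY Y ^ 2) / dN Y else
  if r = 3 ∧ b = 3 then ((49 / 2 : ℚ) * aY Y ^ 3 + (93 / 2 : ℚ) * aY Y ^ 2 * cY Y + (87 / 4 : ℚ) * aY Y * cY Y ^ 2 + 20 * cY Y ^ 3) / dN Y else
  0

/-- the flip rate per red by the type -/
noncomputable def fN (Y : V2Closure.SP) (r b : ℕ) : ℚ :=
  if b = 0 then ((r : ℚ))⁻¹ else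
  if r = 3 ∧ b = 1 then ((98 / 15 : ℚ) * aY Y ^ 3 + (274 / 15 : ℚ) * aY Y ^ 2 * cY Y + (1841 / 90 : ℚ) * aY Y * cY Y ^ 2 + 10 * cY Y ^ 3) / dN Y else
  if r = 4 ∧ b = 1 then ((46 / 15 : ℚ) * cY Y ^ 3) / dN Y else
  if r = 5 ∧ b = 1 then ((133 / 15 : ℚ) * aY Y * cY Y ^ 2 + 10 * cY Y ^ 3) / dN Y else
  if r = 3 ∧ b = 2 then ((343 / 90 : ℚ) * aY Y ^ 3 + (48 / 5 : ℚ) * aY Y ^ 2 * cY Y + (608 / 45 : ℚ) * aY Y * cY Y ^ 2 + (20 / 3 : ℚ) * cY Y ^ 3) / dN Y else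
  if r = 4 ∧ b = 2 then ((49 / 15 : ℚ) * aY Y ^ 3 + (166 / 15 : ℚ) * aY Y ^ 2 * cY Y + (11 / 4 : ℚ) * aY Y * cY Y ^ 2) / dN Y else
  if r = 3 ∧ b = 3 then ((125 / 12 : ℚ) * aY Y * cY Y ^ 2 + 5 * cY Y ^ 3) / dN Y else
  0

/-- the relax rate per red by the type -/
noncomputable def xN (Y : V2Closure.SP) (r b : ℕ) : ℚ :=
  if r = 3 ∧ b = 1 then ((70 / 9 : ℚ) * aY Y ^ 3 + (46 / 3 : ℚ) * aY Y ^ 2 * cY Y + (25 / 3 : ℚ) * aY Y * cY Y ^ 2) / dN Y else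
  if r = 4 ∧ b = 1 then ((112 / 15 : ℚ) * aY Y ^ 3 + (979 / 60 : ℚ) * aY Y ^ 2 * cY Y + (149 / 15 : ℚ) * aY Y * cY Y ^ 2) / dN Y else
  if r = 5 ∧ b = 1 then ((14 / 3 : ℚ) * aY Y ^ 3 + (167 / 15 : ℚ) * aY Y ^ 2 * cY Y) / dN Y else
  if r = 3 ∧ b = 2 then ((301 / 45 : ℚ) * aY Y ^ 3 + (72 / 5 : ℚ) * aY Y ^ 2 * cY Y + (392 / 45 : ℚ) * aY Y * cY Y ^ 2) / dN Y else
  if r = 4 ∧ b = 2 then ((77 / 30 : ℚ) * aY Y ^ 3 + (163 / 30 : ℚ) * aY Y ^ 2 * cY Y + 15 * aY Y * cY Y ^ 2) / dN Y else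
  if r = 3 ∧ b = 3 then ((21 / 2 : ℚ) * aY Y ^ 3 + 24 * aY Y ^ 2 * cY Y + (25 / 3 : ℚ) * aY Y * cY Y ^ 2) / dN Y else
  0

/-- the rate table -/
noncomputable def ratesN (Y : V2Closure.SP) : OCRates 6 where
  ι := fun w => ιN Y (nR 6 w) (nB 6 w)
  f := fun w _ => fN Y (nR 6 w) (nB 6 w)
  x := fun w _ => xN Y (nR 6 w) (nB 6 w)

variable {Y : V2Closure.SP}

/-- `D > 0` -/
theorem dN_pos (hR : 0 < (rSet Y).card) : 0 < dN Y := by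
  unfold dN aY cY
  have : (0 : ℚ) < (rSet Y).card := by exact_mod_cast hR
  positivity

/-- non-negativity of the rates -/
theorem ιN_nonneg (hR : 0 < (rSet Y).card) (r b : ℕ) : 0 ≤ ιN Y r b := by
  have := dN_pos hR
  have ha : (0 : ℚ) < aY Y := by unfold aY; exact_mod_cast hR
  have hc : (0 : ℚ) ≤ cY Y := by unfold cY; positivity
  unfold ιN
  split_ifs <;> positivity

/-- non-negativity of the rates -/
theorem ratesN_iota_nonneg (hR : 0 < (rSet Y).card) (w : Fin 6 → Ltr) : 0 ≤ (ratesN Y).ι w :=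
  ιN_nonneg hR _ _

/-- non-negativity of the rates -/
theorem fN_nonneg (hR : 0 < (rSet Y).card) (r b : ℕ) : 0 ≤ fN Y r b := by
  have := dN_pos hR
  have ha : (0 : ℚ) < aY Y := by unfold aY; exact_mod_cast hR
  have hc : (0 : ℚ) ≤ cY Y := by unfold cY; positivity
  unfold fN
  by_cases h0 : b = 0
  · rw [if_pos h0]; positivity
  · rw [if_neg h0]; split_ifs <;> positivity

/-- non-negativity of the rates -/
theorem ratesN_f_nonneg (hR : 0 < (rSet Y).card) (w : Fin 6 → Ltr) (i : Fin 6) : 0 ≤ (ratesN Y).f w i :=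
  fN_nonneg hR _ _

/-- non-negativity of the rates -/
theorem xN_nonneg (hR : 0 < (rSet Y).card) (r b : ℕ) : 0 ≤ xN Y r b := by
  have := dN_pos hR
  have ha : (0 : ℚ) < aY Y := by unfold aY; exact_mod_cast hR
  have hc : (0 : ℚ) ≤ cY Y := by unfold cY; positivity
  unfold xN
  split_ifs <;> positivity

/-- non-negativity of the rates -/
theorem ratesN_x_nonneg (hR : 0 < (rSet Y).card) (w : Fin 6 → Ltr) (i : Fin 6) : 0 ≤ (ratesN Y).x w i :=
  xN_nonneg hR _ _

/-- `|E(3,0)|` -/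
theorem tailCountN_src (hY : FlowOne Y) : (tailCount (parFin 6 (fun _ => Y)) 3 0 : ℚ) = aY Y ^ 3 * (42 * aY Y ^ 3 + 96 * aY Y ^ 2 * cY Y + 75 * aY Y * cY Y ^ 2 + 20 * cY Y ^ 3) := by
  rw [tailCount_parFin_ident 6 Y hY 3 0]
  unfold aY cY
  simp only [Finset.sum_range_succ, Finset.sum_range_zero]
  norm_num [Nat.choose]
  ring

/-- `|E(2,1)|` -/
theorem tailCountN_tgt (hY : FlowOne Y) : (tailCount (parFin 6 (fun _ => Y)) 2 1 : ℚ) = aY Y ^ 3 * dN Y := by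
  rw [tailCount_parFin_ident 6 Y hY 2 1]
  unfold dN aY cY
  simp only [Finset.sum_range_succ, Finset.sum_range_zero]
  norm_num [Nat.choose]
  ring

/-- `γ_i = c/a` -/
theorem gamN (i : Fin 6) : gam 6 (fun _ => Y) i = cY Y / aY Y := rfl

/-- **the source identity** -/
theorem ratesN_srcOK (hR : 0 < (rSet Y).card) : (ratesN Y).SrcOK (fun _ => Y) 3 0 := by
  intro w hw
  have h3 := nR_add_nB_add_nC 6 w
  have ha : (0 : ℚ) < aY Y := by unfold aY; exact_mod_cast hR
  have hc : (0 : ℚ) ≤ cY Y := by unfold cY; positivity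
  have hD := dN_pos hR
  have hsum : ∀ (φ : ℚ), ∑ i ∈ redSet 6 w, φ = (nR 6 w : ℚ) * φ := by
    intro φ; rw [Finset.sum_const, ← nR_eq_card_redSet, nsmul_eq_mul]
  have hι : ∀ w', (ratesN Y).ι w' = ιN Y (nR 6 w') (nB 6 w') := fun _ => rfl
  have hf : ∀ w' i, (ratesN Y).f w' i = fN Y (nR 6 w') (nB 6 w') := fun _ _ => rfl
  have hx : ∀ w' i, (ratesN Y).x w' i = xN Y (nR 6 w') (nB 6 w') := fun _ _ => rfl
  simp only [gamN, hι, hf, hx]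
  have hcases : (nR 6 w = 3 ∧ nB 6 w = 0) ∨ (nR 6 w = 4 ∧ nB 6 w = 0) ∨ (nR 6 w = 5 ∧ nB 6 w = 0) ∨ (nR 6 w = 6 ∧ nB 6 w = 0) ∨ (nR 6 w = 3 ∧ nB 6 w = 1) ∨ (nR 6 w = 4 ∧ nB 6 w = 1) ∨ (nR 6 w = 5 ∧ nB 6 w = 1) ∨ (nR 6 w = 3 ∧ nB 6 w = 2) ∨ (nR 6 w = 4 ∧ nB 6 w = 2) ∨ (nR 6 w = 3 ∧ nB 6 w = 3) := by
    have := hw.1; omega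
  have hcom : ocCom 6 3 0 w ↔ (3 ≤ nR 6 w ∧ 0 ≤ nB 6 w) ∧ 0 + 1 ≤ nB 6 w := Iff.rfl
  rcases hcases with ⟨hr, hb⟩ | ⟨hr, hb⟩ | ⟨hr, hb⟩ | ⟨hr, hb⟩ | ⟨hr, hb⟩ | ⟨hr, hb⟩ | ⟨hr, hb⟩ | ⟨hr, hb⟩ | ⟨hr, hb⟩ | ⟨hr, hb⟩ <;>
  · simp only [hcom, hr, hb, hsum, ιN, fN, xN]
    norm_num
    try unfold dN
    try field_simp
    try ring

/-- **the target identity** -/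
theorem ratesN_tgtOK (hY : FlowOne Y) (hR : 0 < (rSet Y).card) : (ratesN Y).TgtOK (fun _ => Y) 3 0 := by
  intro w0 ht
  have h3 := nR_add_nB_add_nC 6 w0
  have ha : (0 : ℚ) < aY Y := by unfold aY; exact_mod_cast hR
  have hc : (0 : ℚ) ≤ cY Y := by unfold cY; positivity
  have hD := dN_pos hR
  rw [tailCountN_src hY, tailCountN_tgt hY]
  have hι : ∀ w', (ratesN Y).ι w' = ιN Y (nR 6 w') (nB 6 w') := fun _ => rfl
  have hf : ∀ w' i, (ratesN Y).f w' i = fN Y (nR 6 w') (nB 6 w') := fun _ _ => rfl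
  have hx : ∀ w' i, (ratesN Y).x w' i = xN Y (nR 6 w') (nB 6 w') := fun _ _ => rfl
  simp only [hι, hf, hx]
  have hsumB : ∑ j ∈ blueSet 6 w0, (fN Y (nR 6 (Function.update w0 j Ltr.R)) (nB 6 (Function.update w0 j Ltr.R))
      + (if ocCom 6 3 0 (Function.update w0 j Ltr.R)
          then xN Y (nR 6 (Function.update w0 j Ltr.R)) (nB 6 (Function.update w0 j Ltr.R)) else 0))
      = (nB 6 w0 : ℚ) * (fN Y (nR 6 w0 + 1) (nB 6 w0 - 1)
          + (if (3 ≤ nR 6 w0 + 1 ∧ 0 ≤ nB 6 w0 - 1) ∧ 0 + 1 ≤ nB 6 w0 - 1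
            then xN Y (nR 6 w0 + 1) (nB 6 w0 - 1) else 0)) := by
    rw [nB_eq_card_blueSet, ← nsmul_eq_mul, ← Finset.sum_const]
    apply Finset.sum_congr rfl
    intro j hj
    have hjB : w0 j = Ltr.B := by simpa [blueSet] using hj
    have e1 := nR_update_R 6 w0 j (by rw [hjB]; exact Ltr.noConfusion)
    have e2 := nB_update_R_of_B 6 w0 j hjB
    have e2' : nB 6 (Function.update w0 j Ltr.R) = nB 6 w0 - 1 := by omega
    have hcom : ocCom 6 3 0 (Function.update w0 j Ltr.R)
        ↔ (3 ≤ nR 6 (Function.update w0 j Ltr.R) ∧ 0 ≤ nB 6 (Function.update w0 j Ltr.R))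
          ∧ 0 + 1 ≤ nB 6 (Function.update w0 j Ltr.R) := Iff.rfl
    simp only [hcom, e1, e2']
    rw [nB_eq_card_blueSet]
  have hsumC : ∑ l ∈ cSet 6 w0, xN Y (nR 6 (Function.update w0 l Ltr.R)) (nB 6 (Function.update w0 l Ltr.R))
      = (nC 6 w0 : ℚ) * xN Y (nR 6 w0 + 1) (nB 6 w0) := by
    show _ = ((cSet 6 w0).card : ℚ) * _
    rw [← nsmul_eq_mul, ← Finset.sum_const]
    apply Finset.sum_congr rfl
    intro l hl
    have hlC : w0 l = Ltr.C := by simpa [cSet] using hl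
    have e1 := nR_update_R 6 w0 l (by rw [hlC]; exact Ltr.noConfusion)
    have e2 := nB_update_R_of_ne 6 w0 l (by rw [hlC]; exact Ltr.noConfusion)
    rw [e1, e2]
  rw [hsumB, hsumC]
  have hcases : (nR 6 w0 = 2 ∧ nB 6 w0 = 1) ∨ (nR 6 w0 = 3 ∧ nB 6 w0 = 1) ∨ (nR 6 w0 = 4 ∧ nB 6 w0 = 1) ∨ (nR 6 w0 = 5 ∧ nB 6 w0 = 1) ∨ (nR 6 w0 = 2 ∧ nB 6 w0 = 2) ∨ (nR 6 w0 = 3 ∧ nB 6 w0 = 2) ∨ (nR 6 w0 = 4 ∧ nB 6 w0 = 2) ∨ (nR 6 w0 = 2 ∧ nB 6 w0 = 3) ∨ (nR 6 w0 = 3 ∧ nB 6 w0 = 3) ∨ (nR 6 w0 = 2 ∧ nB 6 w0 = 4) := by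
    have := ht.1; have := ht.2; omega
  have hcom : ocCom 6 3 0 w0 ↔ (3 ≤ nR 6 w0 ∧ 0 ≤ nB 6 w0) ∧ 0 + 1 ≤ nB 6 w0 := Iff.rfl
  rcases hcases with ⟨hr, hb⟩ | ⟨hr, hb⟩ | ⟨hr, hb⟩ | ⟨hr, hb⟩ | ⟨hr, hb⟩ | ⟨hr, hb⟩ | ⟨hr, hb⟩ | ⟨hr, hb⟩ | ⟨hr, hb⟩ | ⟨hr, hb⟩ <;>
  · have hnC : nC 6 w0 = 6 - nR 6 w0 - nB 6 w0 := by omega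
    simp only [hcom, hr, hb, hnC, ιN, fN, xN]
    norm_num
    try unfold dN
    try field_simp
    try ring

/-- **(SD) at `(3,0)` on `6` identical factors** -/
theorem sdomZ_ident_Six30 (hY : FlowOne Y) (hR : 0 < (rSet Y).card) : SDomZ (parFin 6 (fun _ => Y)) 3 0 :=
  sdomZ_of_oneChange (fun _ => hY) (fun _ => hR) (by norm_num) (ratesN Y) (ratesN_iota_nonneg hR)
    (ratesN_f_nonneg hR) (ratesN_x_nonneg hR) (ratesN_srcOK hR) (ratesN_tgtOK hY hR)

end IdentSix30

end Summit.Ventures.PercRepro2.Tail2D
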